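import Literature.MathematicalPhysics.QuantumFieldTheory.Balaban1983to89.B9CubeLettersBondOpsL0
import Literature.MathematicalPhysics.QuantumFieldTheory.Balaban1983to89.B9CubeLettersInvReadings

/-!
# `Balaban1983to89.B9CubeLettersCovarianceL0` — [B9] (3.33)–(3.34) FOR THE CUBE-LOCAL LETTERS OF SECT. C p. 409: `G′_□(U)`, `(Q′G′_□²Q′*)(U)`, `R_□(U)`,
# `C_□(U)`, `Δ_{a,□}(U)`, `G_□(U)` ARE GAUGE COVARIANT — `L(U^u)R(u) = R(u)L(U)` — i.e. the inputs `IsCovSiteOpY`, `IsCovBondOpY`, the block-letter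
# law `hC` and the bi-contraction of the block gauge read of the cell's gauge reduction `B9Cor36GaugeReductionCube.thms31to33_cube_of_reg335''`
# FOR THE CUBE LETTERS (sub-row G-B9-LETTERS, module M5.1c PART 2; `Node00.OpsYGauge` §6–§7 re-instantiated at the cube sequence)

FRAMING (verbatim cell line):
statement-level skeleton of published theorems with citation tags; proofs where landed; nothing here is a claim about the Yang–Mills mass gap

Sources under audit (cell lit-balaban): T. Bałaban, *Propagators for lattice gauge theories in a background field*, Commun. Math. Phys. **99**
(1985) 389–434 [`Balaban1985BackgroundPropagators`, "B9"], (3.28)–(3.34) pp. 395–396, p. 398 («All these inequalities are invariant with respect to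
gauge transformations of U»), p. 408 (proof of Cor. 3.6: «all the results of these theorems are gauge invariant, so they hold for the configuration U
also»), p. 409 l. 3–5 («G′_□(U), C_□(U) = (Q′(U)G′_□²(U)Q′*(U))⁻¹, G_□(U)»).  Held text `paper:balaban1985-cmp99-background-propagators` p0007 ∕ p0008 ∕
p0020 ∕ p0021.  Unit `lit-balaban-r05` (r05 gen 80); lead g29 RULING #5 (P4) = (α) (p21 g31 02:54:11Z: «C_□(U) on the cube blocks plugs into
`thms31to33_cube_of_reg335''` verbatim (`Xc = Yc = Blk_□`, `γX = γY = g read at the cube blocks`)»).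

## WHAT IS PRINTED (verbatim up to notation)

(3.28) p. 395: «U^u_{⟨x,x′⟩} = u(x)U_{⟨x,x′⟩}u⁻¹(x′) … R(U^u(Γ_{y,x})) = R(u(y))R(U(Γ_{y,x}))R(u⁻¹(x))»; (3.33)–(3.34) p. 396: «G′(U^u) = R(u)G′(U)R(u⁻¹),
R(U^u) = R(u)R(U)R(u⁻¹) … Δ_a(U^u) = R(u)Δ_a(U)R(u⁻¹), G(U^u) = R(u)G(U)R(u⁻¹)»; p. 409: the operators `G′_□(U), C_□(U), G_□(U)` are «constructed
for this sequence» by the same formulas, so (3.28)–(3.34) apply to them verbatim.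

## WHAT THIS FILE PROVIDES (two small definitions — the gauge function read on the cube sequence's carriers — and theorems; kernel-checked)

§1 `gBlkCubeY i q g` (the gauge function at the corner site of a block of the cube sequence — def-Y's `gBlkY` with `blkCornerCubeY`), `gIBondCubeY i q g`
(at the initial point of the coarse bond — def-Y's `gIBondY` on the cube sequence's index bonds); `isBiContr_gBlkCubeY ∕ _gIBondCubeY` (a bi-contraction
stays one); the transporter laws `qTc_gaugeY`, `qpTc_gaugeY`, `avgTrCubeY_gaugeY`.
§2 SITE SECTOR: `deltaPrimeACubeY_cov` ((3.31)–(3.32) for `Δ′_{a,□}(U)`), ★ `GpCubeY_cov` ∕ ★★ `GpCubeY_isCovSiteOpY` ((3.33) for `G′_□(U)`: THE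
`IsCovSiteOpY` INPUT of the gauge reduction for the cube letter).
§3 BOND ∕ BLOCK SECTOR: `QCubeY_cov`, `QsCubeY_cov` (via `qsKc_eq_transpose`, `QsCubeY_eq_transpose`), `aKc_eq_diagonal`, `aCubeY_cov`, `QpCubeY_cov`,
`QpsCubeY_cov`, `XCubeY_cov`, `XinvCubeY_cov`, ★ `RCubeY_cov` ((3.33) for `R_□(U)`), ★★ `CCubeY_cov` — THE `hC` INPUT (block letter over the cube
sequence's OWN blocks `BlkCubeY i q`, `γX = γY = gBlkCubeY i q`), ★ `deltaACubeY_cov` ((3.34) for `Δ_{a,□}(U)`), ★★ `GACubeY_cov` ∕ `GACubeY_isCovBondOpY`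
((3.34) for `G_□(U)`: THE `IsCovBondOpY` INPUT) — for ANY lawful contour transporters (`IsGaugeLawS parS`, `IsGaugeLawB parB`; def-Y's taxicab ones by
`parSY_isGaugeLawS ∕ parBY_isGaugeLawB`).

## HONEST SCOPE

* Exact algebra (the `Intw` calculus of `Node00.OpsYGauge`, engine `trLiftY_gauge`); no inequality; the instantiation of
  `B9Cor36GaugeReductionCube.thms31to33_cube_of_reg335''` (choice of `cfg ∕ act`, of the readings `ix, iy : IBondY i → BlkCubeY i q`, and the root
  hypothesis `hroot` = Thms 3.1–3.3 at the small field) is the consumer's (M5.2 ∕ DictB lineage), not done here.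
* Nothing is inferred from the manuscript; kernel-checked; 0 facts.  NOT summit progress; the YM mass gap is not proved by any of this.
-/

namespace Literature.MathematicalPhysics.QuantumFieldTheory.Balaban1983to89.B9CubeLettersCovarianceL0

open LatticeFieldCalculus
open Node00
open Literature.MathematicalPhysics.QuantumFieldTheory.Balaban1983to89.B6KLevelCensusIndexV1 (KIdx)
open Literature.MathematicalPhysics.QuantumFieldTheory.Balaban1983to89.B6Cover236MultiLevelBlocks (cubes)
open Literature.MathematicalPhysics.QuantumFieldTheory.Balaban1983to89.B6Ineq2133TwoScaleV1 (onFun onFun_apply)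
open Literature.MathematicalPhysics.QuantumFieldTheory.Balaban1983to89.B6SectAOperatorsV1 (QsE aE_apply)
open Literature.MathematicalPhysics.QuantumFieldTheory.Balaban1983to89.B6AgreeLapV1Chart (toMatrix'_onFun_adjoint)
open Literature.MathematicalPhysics.QuantumFieldTheory.Balaban1983to89.B15DeterminingSets (embIter)
open Literature.MathematicalPhysics.QuantumFieldTheory.Balaban1983to89.B9CubeLettersOpsL0 (cubeFamY levCubeY avgTrCubeY deltaPrimeACubeY GpCubeY)
open Literature.MathematicalPhysics.QuantumFieldTheory.Balaban1983to89.B9CubeBondWeights (domCube wCubeBond)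
open Literature.MathematicalPhysics.QuantumFieldTheory.Balaban1983to89.B9CubeLettersInvReadings (IsBiContr)
open Literature.MathematicalPhysics.QuantumFieldTheory.Balaban1983to89.B9CubeLettersBondOpsL0
open scoped Matrix

noncomputable section

variable {d ℓ : ℕ} {hd : 1 ≤ d + 1} {hL : Odd (ℓ + 1) ∧ 1 < ℓ + 1} {b₀ b₁ : ℝ}
variable {𝔸 : Type} [NormedRing 𝔸] [NormedAlgebra ℂ 𝔸] [CompleteSpace 𝔸]

/-! ## §1 The gauge function on the cube sequence's carriers; the transporter laws -/

section Reads

variable (i : KIdx d ℓ hd hL b₀ b₁) (q : ↥(cubes (toKT i).D.toDomains))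

/-- `u` at the CORNER SITE of a block of the cube sequence (the transport target of `Q′_□(U)`). [cite: Balaban1985BackgroundPropagators, (3.19) p.393, (3.28) p.395, (3.32) p.395] -/
def gBlkCubeY (g : GaugeY 𝔸 i) : BlkCubeY i q → 𝔸ˣ := fun s => gSiteY i g (blkCornerCubeY i q s)

/-- `u` at the INITIAL POINT of an index bond of the cube sequence (the transport target of `Q_□(U)`). [cite: Balaban1985BackgroundPropagators, (3.12)–(3.14) pp.392–393, (3.28) p.395] -/
def gIBondCubeY (g : GaugeY 𝔸 i) : IBondCubeY i q → 𝔸ˣ := fun ι => g (embIter (ι.1.1 : ℕ) ι.1.2.src)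

variable {i q} in
/-- a bi-contraction read at the cube blocks is a bi-contraction (the `hγ` input of `thms31to33_cube_of_reg335''`). [cite: Balaban1985BackgroundPropagators, p.390 («G ⊂ U(N)»), (3.28) p.395, bookkeeping] -/
theorem isBiContr_gBlkCubeY {g : GaugeY 𝔸 i} (hg : IsBiContr g) : IsBiContr (gBlkCubeY i q g) := fun _ => hg _

variable {i q} in
/-- a bi-contraction read at the cube sequence's index bonds is a bi-contraction. [cite: Balaban1985BackgroundPropagators, p.390, (3.28) p.395, bookkeeping] -/
theorem isBiContr_gIBondCubeY {g : GaugeY 𝔸 i} (hg : IsBiContr g) : IsBiContr (gIBondCubeY i q g) := fun _ => hg _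

variable {i} in
/-- the `Q_□(U)` transporters transform as contour variables: `T′(ι, b) = u(y_ι)T(ι, b)u(b₋)⁻¹`. [cite: Balaban1985BackgroundPropagators, (3.12)–(3.14) pp.392–393, (3.32) pp.395–396] -/
theorem qTc_gaugeY {parB : BondParY 𝔸 i} (hB : IsGaugeLawB i parB) (g : GaugeY 𝔸 i) (U : CfgY 𝔸 i) (ι : IBondCubeY i q) (b : FBondY i) :
    qTc i q parB (gaugeY i g U) ι b = gIBondCubeY i q g ι * qTc i q parB U ι b * (gBondY i g b)⁻¹ := hB g U _ _

variable {i} in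
/-- the `Q′_□(U)` transporters transform as contour variables: `T′(s, z) = u(c_s)T(s, z)u(z)⁻¹`. [cite: Balaban1985BackgroundPropagators, (3.19) p.393, (3.32) p.395] -/
theorem qpTc_gaugeY {parS : SiteParY 𝔸 i} (hS : IsGaugeLawS i parS) (g : GaugeY 𝔸 i) (U : CfgY 𝔸 i) (s : BlkCubeY i q) (z : SiteY i) :
    qpTc i q parS (gaugeY i g U) s z = gBlkCubeY i q g s * qpTc i q parS U s z * (gSiteY i g z)⁻¹ := hS g U _ _

variable {i} in
/-- the averaging transporter of `Δ′_{a,□}(U)` through the corner of the cube sequence's block transforms as a contour variable.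
[cite: Balaban1985BackgroundPropagators, (3.19) p.393, (3.24) p.394, (3.28) p.395] -/
theorem avgTrCubeY_gaugeY {parS : SiteParY 𝔸 i} (hS : IsGaugeLawS i parS) (g : GaugeY 𝔸 i) (U : CfgY 𝔸 i) (z w : SiteY i) :
    avgTrCubeY i q parS (gaugeY i g U) z w = gSiteY i g z * avgTrCubeY i q parS U z w * (gSiteY i g w)⁻¹ := by
  rw [avgTrCubeY, avgTrCubeY, hS, hS]
  simp only [mul_assoc, inv_mul_cancel_left]

end Reads

/-! ## §2 The site sector: (3.31)–(3.33) for `Δ′_{a,□}(U)` and `G′_□(U) = Δ′_{a,□}(U)⁻¹` -/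

section SiteSector

variable (i : KIdx d ℓ hd hL b₀ b₁) (q : ↥(cubes (toKT i).D.toDomains)) (g : GaugeY 𝔸 i) (U : CfgY 𝔸 i)

variable {i} in
/-- ★ **(3.31)–(3.32) FOR `Δ′_{a,□}(U)`**: `Δ′_{a,□}(U^u)R(u) = R(u)Δ′_{a,□}(U)`. [cite: Balaban1985BackgroundPropagators, (3.24) p.394, (3.31)–(3.32) p.395, p.409 l.3–5] -/
theorem deltaPrimeACubeY_cov {parS : SiteParY 𝔸 i} (hS : IsGaugeLawS i parS) :
    Intw (conjY (gSiteY i g)) (conjY (gSiteY i g)) (deltaPrimeACubeY i q parS U) (deltaPrimeACubeY i q parS (gaugeY i g U)) := by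
  unfold deltaPrimeACubeY
  refine (lapSL_cov i g U).add ?_
  rw [kernelTrOpY_eq_trLiftY, kernelTrOpY_eq_trLiftY]
  exact intw_trLiftY _ _ _ _ _ fun z w _ => avgTrCubeY_gaugeY q hS g U z w

variable {i} in
/-- ★ **(3.33) FOR `G′_□(U) = Δ′_{a,□}(U)⁻¹`**: `G′_□(U^u)R(u) = R(u)G′_□(U)` (the `Ring.inverse`s are conjugate). [cite: Balaban1985BackgroundPropagators, (3.33) p.396 («G′(U^u) = R(u)G′(U)R(u⁻¹)»), p.409 l.3–5] -/
theorem GpCubeY_cov {parS : SiteParY 𝔸 i} (hS : IsGaugeLawS i parS) :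
    Intw (conjY (gSiteY i g)) (conjY (gSiteY i g)) (GpCubeY i q parS U) (GpCubeY i q parS (gaugeY i g U)) :=
  (deltaPrimeACubeY_cov q g U hS).ringInverse (isUnit_conjY _)

variable {i} in
/-- ★★ **`G′_□(U)` IS A COVARIANT SITE-SECTOR LETTER** (the `IsCovSiteOpY` input of `B9Cor36GaugeReductionCube.thms31to33_cube_of_reg335''` and of
`B9CubeLettersGaugeTransport.kernelReadingsInvariant_SInv`, for the cube letter). [cite: Balaban1985BackgroundPropagators, (3.33) p.396, p.408 («all the results of these theorems are gauge invariant»), p.409 l.3–5] -/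
theorem GpCubeY_isCovSiteOpY {parS : SiteParY 𝔸 i} (hS : IsGaugeLawS i parS) : IsCovSiteOpY i (GpCubeY i q parS) :=
  fun g U => GpCubeY_cov q g U hS

end SiteSector

/-! ## §3 The bond ∕ block sector: (3.32)–(3.34) for `Q_□`, `Q*_□`, `a_□`, `Q′_□`, `Q′*_□`, `(Q′G′_□²Q′*)`, `R_□`, `C_□`, `Δ_{a,□}`, `G_□` -/

section BondSector

variable (i : KIdx d ℓ hd hL b₀ b₁) (q : ↥(cubes (toKT i).D.toDomains)) (g : GaugeY 𝔸 i) (U : CfgY 𝔸 i)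

/-- (3.13) at the level of flat kernels: the cube sequence's `Q*` kernel is the transpose of its `Q` kernel. [cite: Balaban1985BackgroundPropagators, (3.13) p.392; Balaban1984PropagatorsII, (2.18) p.226] -/
theorem qsKc_eq_transpose : qsKc i q = (qKc i q)ᵀ := by
  unfold qsKc qKc QsE
  exact toMatrix'_onFun_adjoint _

/-- `Q*_□(U)` is the transported lift of the transposed `Q_□` kernel along the inverted transporters. [cite: Balaban1985BackgroundPropagators, (3.13) p.392, p.409] -/
theorem QsCubeY_eq_transpose (parB : BondParY 𝔸 i) (U : CfgY 𝔸 i) :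
    QsCubeY i q parB U = trLiftY (qKc i q)ᵀ fun b ι => (qTc i q parB U ι b)⁻¹ := by
  rw [← qsKc_eq_transpose]; rfl

variable {i} in
/-- ★ (3.32) for `Q_□(U)`. [cite: Balaban1985BackgroundPropagators, (3.12)–(3.14) pp.392–393, (3.32) pp.395–396, p.409] -/
theorem QCubeY_cov {parB : BondParY 𝔸 i} (hB : IsGaugeLawB i parB) :
    Intw (conjY (gBondY i g)) (conjY (gIBondCubeY i q g)) (QCubeY i q parB U) (QCubeY i q parB (gaugeY i g U)) :=
  intw_trLiftY _ _ _ _ _ fun ι b _ => qTc_gaugeY q hB g U ι b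

variable {i} in
/-- ★ (3.32) for `Q*_□(U)`. [cite: Balaban1985BackgroundPropagators, (3.13) p.392, (3.32) pp.395–396, p.409] -/
theorem QsCubeY_cov {parB : BondParY 𝔸 i} (hB : IsGaugeLawB i parB) :
    Intw (conjY (gIBondCubeY i q g)) (conjY (gBondY i g)) (QsCubeY i q parB U) (QsCubeY i q parB (gaugeY i g U)) := by
  rw [QsCubeY_eq_transpose, QsCubeY_eq_transpose]
  exact intw_trLiftY_transpose _ _ _ _ _ fun ι b _ => qTc_gaugeY q hB g U ι b

/-- the cube sequence's weight matrix is diagonal: `a_□(ι, ι′) = w_□(ι)[ι = ι′]`. [cite: Balaban1984PropagatorsII, (2.18)–(2.20) p.226 («a multiplication operator»); Balaban1985BackgroundPropagators, p.409, dictionary] -/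
theorem aKc_eq_diagonal : aKc i q = Matrix.diagonal (wCubeBond i q) := by
  ext ι ι'
  rw [aKc, LinearMap.toMatrix'_apply, onFun_apply, aE_apply, Matrix.diagonal_apply, WithLp.ofLp_toLp, Pi.single_apply]
  split_ifs <;> simp

/-- (3.34)′ for the weight `a_□` (a real diagonal weight commutes with `R(u)`). [cite: Balaban1985BackgroundPropagators, (3.26) p.395, (3.34) p.396] -/
theorem aCubeY_cov : Intw (conjY (gIBondCubeY i q g)) (conjY (gIBondCubeY i q g)) (aCubeY (𝔸 := 𝔸) i q) (aCubeY i q) := by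
  rw [aCubeY, aKc_eq_diagonal]
  exact intw_liftMatY_diagonal _ _

variable {i} in
/-- ★ (3.32) for `Q′_□(U)`: `Q′_□(U^u)R(u) = R(u)Q′_□(U)` with `u` read at the cube blocks' corners. [cite: Balaban1985BackgroundPropagators, (3.19) p.393, (3.32) p.395, p.409] -/
theorem QpCubeY_cov {parS : SiteParY 𝔸 i} (hS : IsGaugeLawS i parS) :
    Intw (conjY (gSiteY i g)) (conjY (gBlkCubeY i q g)) (QpCubeY i q parS U) (QpCubeY i q parS (gaugeY i g U)) :=
  intw_trLiftY _ _ _ _ _ fun s z _ => qpTc_gaugeY q hS g U s z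

variable {i} in
/-- ★ (3.32) for `Q′*_□(U)`. [cite: Balaban1985BackgroundPropagators, (3.24)–(3.25) p.394, (3.32) p.395, p.409] -/
theorem QpsCubeY_cov {parS : SiteParY 𝔸 i} (hS : IsGaugeLawS i parS) :
    Intw (conjY (gBlkCubeY i q g)) (conjY (gSiteY i g)) (QpsCubeY i q parS U) (QpsCubeY i q parS (gaugeY i g U)) :=
  intw_trLiftY _ _ _ _ _ fun z s _ => by rw [qpTc_gaugeY q hS, mul_inv_rev, mul_inv_rev, inv_inv, mul_assoc]

variable {i g U}
variable {parS : SiteParY 𝔸 i} {parB : BondParY 𝔸 i}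

/-- (3.33)′ for `(Q′G′_□²Q′*)(U)`. [cite: Balaban1985BackgroundPropagators, (3.25) p.394, (3.33) p.396, p.409] -/
theorem XCubeY_cov (hS : IsGaugeLawS i parS) :
    Intw (conjY (gBlkCubeY i q g)) (conjY (gBlkCubeY i q g)) (XCubeY i q parS U) (XCubeY i q parS (gaugeY i g U)) :=
  (QpCubeY_cov q g U hS).comp ((GpCubeY_cov q g U hS).comp ((GpCubeY_cov q g U hS).comp (QpsCubeY_cov q g U hS)))

/-- (3.33)′ for `(Q′G′_□²Q′*)⁻¹(U)`. [cite: Balaban1985BackgroundPropagators, (3.25) p.394, (3.33) p.396, p.409] -/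
theorem XinvCubeY_cov (hS : IsGaugeLawS i parS) :
    Intw (conjY (gBlkCubeY i q g)) (conjY (gBlkCubeY i q g)) (XinvCubeY i q parS U) (XinvCubeY i q parS (gaugeY i g U)) :=
  (XCubeY_cov q hS).ringInverse (isUnit_conjY _)

/-- ★ **(3.33) FOR THE PROJECTION `R_□(U)` (3.25)**: `R_□(U^u)R(u) = R(u)R_□(U)`. [cite: Balaban1985BackgroundPropagators, (3.25) p.394, (3.33) p.396 («R(U^u) = R(u)R(U)R(u⁻¹)»), p.409] -/
theorem RCubeY_cov (hS : IsGaugeLawS i parS) :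
    Intw (conjY (gSiteY i g)) (conjY (gSiteY i g)) (RCubeY i q parS U) (RCubeY i q parS (gaugeY i g U)) :=
  Intw.id.sub ((GpCubeY_cov q g U hS).comp ((QpsCubeY_cov q g U hS).comp ((XinvCubeY_cov q hS).comp ((QpCubeY_cov q g U hS).comp
    (GpCubeY_cov q g U hS)))))

/-- ★★ **(3.33)′ FOR THE LETTER `C_□(U) = (Q′(U)G′_□²(U)Q′*(U))⁻¹`**: `C_□(U^u)R(u) = R(u)C_□(U)` on the cube sequence's blocks — THE `hC` INPUT of
`B9Cor36GaugeReductionCube.thms31to33_cube_of_reg335''` with `Xc = Yc := BlkCubeY i q`, `γX = γY := gBlkCubeY i q`, `C := CCubeY i q parS`.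
[cite: Balaban1985BackgroundPropagators, (3.48) p.398, (3.33) p.396, p.409 l.3–5 («C_□(U) = (Q′(U)G′_□²(U)Q′*(U))⁻¹»)] -/
theorem CCubeY_cov (hS : IsGaugeLawS i parS) (g : GaugeY 𝔸 i) (U : CfgY 𝔸 i) :
    Intw (conjY (gBlkCubeY i q g)) (conjY (gBlkCubeY i q g)) (CCubeY i q parS U) (CCubeY i q parS (gaugeY i g U)) :=
  (XinvCubeY_cov q hS).comp (intw_liftMatY_diagonal _ _)

/-- ★ **(3.34) FOR `Δ_{a,□}(U)` (3.26)**: `Δ_{a,□}(U^u)R(u) = R(u)Δ_{a,□}(U)`. [cite: Balaban1985BackgroundPropagators, (3.26) p.395, (3.34) p.396 («Δ_a(U^u) = R(u)Δ_a(U)R(u⁻¹)»), p.409 l.3–5] -/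
theorem deltaACubeY_cov (hS : IsGaugeLawS i parS) (hB : IsGaugeLawB i parB) :
    Intw (conjY (gBondY i g)) (conjY (gBondY i g)) (deltaACubeY i q parS parB U) (deltaACubeY i q parS parB (gaugeY i g U)) :=
  ((hessY_cov i g U).add ((gradY_cov i g U).comp ((RCubeY_cov q hS).comp (divY_cov i g U)))).add
    ((QsCubeY_cov q g U hB).comp ((aCubeY_cov i q g).comp (QCubeY_cov q g U hB)))

/-- ★★ **(3.34) FOR `G_□(U) = Δ_{a,□}(U)⁻¹` (3.27)**: `G_□(U^u)R(u) = R(u)G_□(U)`. [cite: Balaban1985BackgroundPropagators, (3.27) p.395, (3.34) p.396 («G(U^u) = R(u)G(U)R(u⁻¹)»), p.409 l.3–5] -/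
theorem GACubeY_cov (hS : IsGaugeLawS i parS) (hB : IsGaugeLawB i parB) :
    Intw (conjY (gBondY i g)) (conjY (gBondY i g)) (GACubeY i q parS parB U) (GACubeY i q parS parB (gaugeY i g U)) :=
  (deltaACubeY_cov q hS hB).ringInverse (isUnit_conjY _)

/-- ★★ **`G_□(U)` IS A COVARIANT BOND-SECTOR LETTER** (the `IsCovBondOpY` input of `B9Cor36GaugeReductionCube.thms31to33_cube_of_reg335''` and of
`B9CubeLettersGaugeTransport.kernelReadingsInvariant_BInv`, for the cube letter). [cite: Balaban1985BackgroundPropagators, (3.34) p.396, p.408 («all the results of these theorems are gauge invariant»), p.409 l.3–5] -/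
theorem GACubeY_isCovBondOpY (hS : IsGaugeLawS i parS) (hB : IsGaugeLawB i parB) : IsCovBondOpY i (GACubeY i q parS parB) :=
  fun _ _ => GACubeY_cov q hS hB

/-- with def-Y's TAXICAB transporters: `G′_□`, `G_□` are covariant and `C_□` obeys the block law (no hypothesis left).
[cite: Balaban1985BackgroundPropagators, (3.28) p.395, (3.33)–(3.34) p.396, (3.40) p.397, p.409 l.3–5] -/
theorem cubeLetters_cov_taxicab :
    IsCovSiteOpY i (GpCubeY i q (parSY (𝔸 := 𝔸) i)) ∧ IsCovBondOpY i (GACubeY i q (parSY (𝔸 := 𝔸) i) (parBY i)) ∧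
      ∀ (g : GaugeY 𝔸 i) (U : CfgY 𝔸 i), Intw (conjY (gBlkCubeY i q g)) (conjY (gBlkCubeY i q g))
        (CCubeY i q (parSY i) U) (CCubeY i q (parSY i) (gaugeY i g U)) :=
  ⟨GpCubeY_isCovSiteOpY q (parSY_isGaugeLawS i), GACubeY_isCovBondOpY q (parSY_isGaugeLawS i) (parBY_isGaugeLawB i),
    CCubeY_cov q (parSY_isGaugeLawS i)⟩

end BondSector

end

end Literature.MathematicalPhysics.QuantumFieldTheory.Balaban1983to89.B9CubeLettersCovarianceL0
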